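import Summits.HodgeConjecture.HodgeConjecture.Theorems.H413SpectrumInterfacesKernel
import Summits.HodgeConjecture.HodgeConjecture.Theorems.P2StubU1RealisationAt
import Summits.HodgeConjecture.HodgeConjecture.Theorems.P2StubU2OfLetters
import Summits.HodgeConjecture.HodgeConjecture.Theorems.H413ThetaPinBridge
import Summits.HodgeConjecture.HodgeConjecture.Theorems.P2StubU2OfLettersCD
import Summits.HodgeConjecture.HodgeConjecture.Theorems.F0P2dSocketD
import Literature.NumberTheory.Automorphic.UnitaryGroupCotangentSpectralProjectionConj
import HarnessLib

/-!
# EDITION v4a (A-p18 (g16) on F0P2-plan (g0)'s WORD 2026-08-30T22:47:58Z + RULING 22:59:24Z) — IMPORT-BASED DEDUPE over ★ (A)∕(B) + BY-NAME FOLDS of U1′ and U2′;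
# NO STATEMENT CHANGE (every stub TYPE is the ★ module constant whose body is token-identical to v3∕v3.1, F0P2-ref1 r1∕r2 declseg 21∕21); U4 STAYS the registered socket.

HC_CM is proved only modulo the 7 printed citations until rung 0 closes.

EDITION v4b (draft F0P2-p01 (g2), 2026-08-30T23:3xZ, for the registrar): = v4a 2c346c57e34cce2b + ONE by-name fold — the socket (D̄)
`stub_D_antiholCotFormSpectralProjection` is DISCHARGED from (D) by ★ p794879 `Literature/NumberTheory/Automorphic/UnitaryGroupCotangentSpectralProjectionConj.lean`
(`CotangentForms.antiholCotFormSpectralProjection_of_hol`: complex conjugation of discrete summands); `+ import` of that module; NO statement byte changed;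
`sorry` count 5 → 4 = {C, C′, D, U4}.

EDITION v4c (draft F0P2-p02 (g2), 2026-08-31T01:1xZ, for the registrar; pre-approved on statement grounds F0P2-ref1 r25, F0P2-plan (g2) 00:03:40Z «R1 RESOLVED … GO»):
= v4b 8773907895f5fd68 + the socket (C′) REMOVED — `stub_U2_cohFormsSpectrumIsThetaAt` is now the one-line fold of ★ p796532
`Theorems/P2StubU2OfLettersCD.lean :: P2StubU2OfLettersCD.stub_U2_cohFormsSpectrumIsThetaAt_of_C_D stub_C_cohFinComponentIsTheta stub_D_holCotFormSpectralProjection`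
(F0P2-p02 (g0): U2′ from (C) + (D) alone — (C′) discharged inside by F0P4-p06's ★ master p795659 via ★ p796158 `ThetaPinBridge.spectrumIsTheta_of_cohFinComponent_of_master`,
(D̄) by ★ p794879); the v4a-born socket theorem `stub_Cprime_lineClassTransport` (NOT one of the three registered stubs U1′∕U2′∕U4) is DELETED; `+ import` of p796532;
NO registered statement byte changed; `sorry` count 4 → 3 = {C, D, U4}.

EDITION v4d (draft F0P2-p02 (g2), 2026-08-31T01:3xZ, for the registrar): = v4c + the socket (D) FOLDED BY NAME over ★ p799091
`Theorems/F0P2dSocketD.lean :: F0P2dSocketD.holCotFormSpectralProjection_holds` (the (D)-desk sub-line `F0_P2SpectralProjectionD`, stubs K∕S∕H∕R∕G∕T ★,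
assembly F0P2-p01 (g2)); `+ import`; NO registered statement byte changed; `sorry` count 3 → 2 = {C, U4}.

What changed vs the tree's v3.1 (c45e9c014ff2923d; v3 8c6e58a88c25df35 + A-plan1 (g17)'s U1′ by-name fold):
* every DEFINITION and every sorry-free THEOREM of v3 (§0 floor types `HdictEType`∕`HJ3aType`∕`HoccType` + `hdictEType_iff_datum413`, §2 generic shapes `IsGlobalEps`,
  `HeckeRelatedAt`, `OccursIn`, `RealisedIn`, `SpectrumIsThetaAtLevel`, `OmegaIrreducibleOrZero`, `HeckeLevelRigidity`, `heckeLevelRigidity_of_omegaIrreducibleOrZero`,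
  `OccurringGlobalThetaIsAdmissible`, `occursIn_of_realisedIn`, `dictionaryExistence_of_parts`, §3 stub TYPES `StubU1RealisationAt`∕`StubU2CohFormsSpectrumIsThetaAt`∕
  `StubU4SignRule` + `omegaIrreducibleOrZero_datum413`, §4 `oscillatorTriple_dictionaryExistence_holds_of`) now lives ★ in the tree as the shared module pair
  `Theorems/H413SpectrumInterfaces.lean` (p792253, 086981b39bc30294) + `Theorems/H413SpectrumInterfacesKernel.lean` (p792880, c1bf8fb6c3d7049d), namespace
  `Summit.HodgeConjecture.HodgeConjecture.Cruxes.H413.SpectrumInterfaces` (courier A-p18 (g15) on F0P2-plan (g0)'s box) — this file IMPORTS them and restates nothing;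
* U1′ IS PROVED (as v3.1): `stub_U1_realisationAt` is the one-line fold of ★ `…Cruxes.H413.TowerRealisation.stubU1RealisationAt_holds : SpectrumInterfaces.StubU1RealisationAt`
  (F0P2-p04 (g0), p792926 over p792100∕p792047∕p792363);
* U2′ IS FOLDED BY NAME ON THE DETECTION ROUTE (F0P2-plan (g0) RULING 2026-08-30T22:16:17Z; F0P2-ref1 r9 kernel probe GREEN):
  `stub_U2_cohFormsSpectrumIsThetaAt := P2StubU2OfLetters.stubU2_of_letters stub_D_holCotFormSpectralProjection stub_D_antiholCotFormSpectralProjection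
  (ThetaPinBridge.spectrumIsTheta_of_cohFinComponent stub_C_cohFinComponentIsTheta stub_Cprime_lineClassTransport)` over ★ p793253 `Theorems/P2StubU2OfLetters.lean` (F0P2-p03)
  and ★ p793582 `Theorems/H413ThetaPinBridge.lean` (F0P2-p02), with FOUR SOCKET STUBS whose TYPES are ★ statement-only Literature constants BY NAME (class U, one currency, s341∕s355:
  no `[cite:` tag on a socket — the print anchors are prose): (C) `stub_C_cohFinComponentIsTheta : Literature.NumberTheory.Rogawski1990.cohFinComponent_isTheta` (★ p791977;
  ENGINE E2∕E2b: Rogawski 13.3.6 (c), §14.6, §15.3; GR91 5.1.1∕5.1.2), (C′) `stub_Cprime_lineClassTransport :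
  Literature.NumberTheory.Automorphic.Liu2021.Def411WeilCarriers.rhoAtLine_lineClassTransport` (★ p793466; = the injective half of P4's S4a, A-p17's master closes both), (D)
  `stub_D_holCotFormSpectralProjection : Literature.NumberTheory.Automorphic.UnitaryGroup.CotangentForms.holCotFormSpectralProjection` and (D̄)
  `stub_D_antiholCotFormSpectralProjection : …antiholCotFormSpectralProjection` (★ p792838; spectral projection, M–L in-tree later);
* U4 `stub_U4_signRule : StubU4SignRule := by sorry` STAYS the registered socket (F0P2-plan RULING 22:59:24Z on F0P2-ref1 O11-1: v4b CANCELLED; ★ p794032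
  `Theorems/P2StubU4OfParity.lean :: stubU4_of_parity (hE3 : StubE3OccurrenceParityAt) : StubU4SignRule` is an ADAPTER into the engine's parity dialect, not a close);
* heads keep their v3 NAMES in this namespace and are one-line folds of the ★ Kernel compositions (`SpectrumInterfaces.oscillatorTriple_dictionaryExistence_holds_of`) and of ★
  `Hyp413Closing.H413_of_three_facts_flat`.
`sorry` count = EXACTLY 5 = {C, C′, D, D̄, U4} = P2's FLOOR-0 HOLE CENSUS (PLAN-P2 v1.2 §6.3 corrected): four class-U engine∕analysis sockets + the sign rule.
The v3 header (A-p18 (g15)) follows unchanged for the record; its §0∕§2∕§3-types text now describes the ★ module pair.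
-/

/-!
# FLOOR-0 programme P2 — LINE `P2ThetaDictionaryExists` (skeleton v2.3): the `hdictE` binder of the generic floor — «every irreducible
# `U(V)(𝔸_{F⁺,f})`-constituent of `H¹_{B,τ'}(A_∞, ℂ)` is an `ω(μ, ε, χ)` with `μ` of weight one and `ε` `μ`-admissible» ([Liu2021] proof of
# Prop. 4.13 l. 2145, first sentence ∕ [GR91] Introduction p. 448 + Thm 5.1.1 at `n = 3`) — CUT into three registered stubs over the tree's REAL
# carriers (the `(1,0) ⊕ (0,1)` cotangent automorphic forms of `U(V)` AT THE FACTOR OF RECORD as the middle object) plus two links CLOSED BY NAME, composition kernel-checked (v2.3)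

Cell `hodgecm-mathlib` (D-0151), human ruling D-0183 «FLOOR 0» (director s317, `director/F0/FLOOR0-PLAN.v1.1.md`), programme **P2** (director s322 (1);
desk A-plan1 (g17), brief `A-plan/F0P2/BRIEF-P2-skeleton.A-plan1g17.md` 1b762746f96c261c); author A-p18 (g15), 2026-08-30.  Crux item of record:
stmt-HodgeConjecture-24833 (`H413`); registry line `Cruxes/H413/Lines/a3_liu413.lean` v10.2 0227045a, whose registered FACT-level stub
`stub_oscillatorTriple_dictionaryExistence` (:271–276) THIS line re-cuts into proof obligations.  Tree name on registration:
`Summits/HodgeConjecture/HodgeConjecture/Cruxes/H413/Lines/P2ThetaDictionaryExists.lean`.  `sorry` ONLY in the three `stub_U*` (U1′, U2′, U4; v1's U3 «Hecke-level rigidity» is a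
THEOREM here: ★ `HeckeFixedVectorsLift` + ★ `H411_proof`; v2's U0 «an honest archimedean factor exists» LEFT the composition — the stubs speak about the CONSTRUCTED factor
`archFactorOf F V`, A-plan1 (g17) 19:41:49Z GO (a)); no instance, no notation, no axiom, no named fact.  HC_CM is proved only modulo the 7 printed citations until rung 0 closes; this file proves NOTHING about them — it fixes the decomposition of
ONE of the five FLOOR-0 binders (`hdictE`) into named lemmas over existing declarations and checks the composition in the kernel.

## TARGET (verbatim)
`HdictEType` := the TYPE of the `hdictE` binder of ★ p756419 `Theorems/HCCMUnconditionalOfGenericFloorV7.lean` (ll. 72–75, BYTE-FOR-BYTE under the floor's `open`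
block) = token-for-token the statement of `Cruxes/H413/Lines/a3_liu413.lean` v10.2 :271–276 `stub_oscillatorTriple_dictionaryExistence`; letter =
`Literature.NumberTheory.GelbartRogawski1991.oscillatorTriple_dictionaryExistence (P : Prop413Data F E) : Prop :=
  P.n = 3 → ∀ τ' W σ, σ.IsIrreducible → OccursInH1 P τ' σ → ∃ t : P.AdmTriple, IsIsoToOmega P σ t.1`
(`OscillatorTripleExistenceAndOccurrence.lean` :62–64; carriers `OccursInH1` ∕ `IsIsoToOmega` ∕ `rhoTriple` of `OscillatorTripleDictionary.lean`) at the printed datum of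
every face `P = datum413 hDel F V a₀ Φ i` (★ `CorCM/Hyp413/A3Liu413FaceTypes.lean` :179 — the SAME term, `hdictEType_iff_datum413 : … ↔ …` is `Iff.rfl`).  Here
`P.G = U(V)(𝔸_{F⁺,f}) = ↥V.adelicFin`, `P.rho μ hμ ε χ = ω_V(μ, ε, χ)` are the tree's OWN Def. 4.11 oscillator modules (`Model.uniformOmegaRep`, `Def411WeilCarriersAtLine`),
and `P.HB τ' = H`, the PIN's tower colimit of `H¹(P_Γ(V); ℂ)` with its Hecke action (`HodgeCM.Model.liuDictionaryPin … .H`, `Representation.ofModule' H`).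

## WHAT THE TARGET SAYS, AND THE ENGINE IT NEEDS (this seat's finding, numbers not adjectives)
`hdictE` is the **EXHAUSTION** half of [Liu2021, Prop. 4.13]: every irreducible `U(V)(𝔸_{F⁺,f})`-constituent of `H¹` of the (compact) unitary Shimura surfaces IS a theta
representation.  Printed road ([Liu2021, Rem. 4.14], `n = 3`): Matsushima ([BW00, VII 3.2∕3.6]) ⇒ `σ = π^∞` for an automorphic `π` of `U(V)` with `H¹(𝔤, K_∞; π_∞) ≠ 0`;
[BW00 VI]∕[VZ84] ⇒ `π_{ι₁} ∈ {J⁺, J⁻}` (non-tempered); [Rogawski1990, Thm. 13.3.6 (c) with §14.6 for the anisotropic INNER FORM `U(V)`] ⇒ `π ∈ Π(ρ)`, `dim ρ = 1`; [GR91,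
Lem. 5.1.2 ∕ Thm. 5.1.1] ⇒ `π_v` is a local Weil representation at every finite `v`, i.e. `π^∞ ≅ ω(μ,ε,χ)` ([Liu2021, App. D proof of Lem. D.1, l. 5241∕5255] for the
dictionary).  The classification step is ROGAWSKI'S STABLE TRACE FORMULA for `U(3)` AND its inner forms (`GelbartRogawski1991/WeilRepresentationsAPackets.lean` :19–29
«GENERALITY»: [GR91]'s global statements are for the QUASI-SPLIT `U(3)`; our `U(V)` is anisotropic — `6 ≤ [F:ℚ]`, `V` definite at the other real places; ibid.
:238–246 `intro_h1_weil` = [R] §15.3 with 13.3.6) — so **P2 shares P3's engine**.  FLOOR0-PLAN v1.1 §1 P2's U1–U6 (local Weil representation ∕ Howe duality ∕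
theta automorphy ∕ Rallis ∕ local–global) are the CONSTRUCTIVE pipeline: they prove the CONVERSE direction (programme P4's theta road, the (⇐) record
`admissible_occursInH1`) and nothing toward exhaustion.  Reported on the cell bus 2026-08-30T18:58:15Z.

## THE MIDDLE OBJECT IS CONCRETE AND SHARED BY NAME (A-plan1 (g17) 2026-08-30T19:07:55Z ∕ 19:12:10Z ∕ 19:35:25Z)
The carriers are the BUILT tree module `Summits/HodgeConjecture/HodgeConjecture/Theorems/H413CohFormsCarriers.lean` (A-p13 (g21)'s §1–§2 cut out sorry-free = the crux workfile
`Cruxes/H413/Lines/CohFormsCarriers.lean` commit accd50068376, sha16 efb3094ce22351d9, re-homed under `Theorems/` so that importers elaborate), imported here and by programme P4's line: the adelic datum `𝒢(V) := UnitaryGroup.adelicGroupData F⁺ K c̄ 3 (Hm V)` (★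
`Automorphic/UnitaryGroupAutomorphicRep`; its finite-adelic points `UnitaryGroup.finAdelic … (Hm V)` ARE the pin's `P.G = ↥V.adelicFin`, the SAME declaration, with ★
`UnitaryGroup.finAdelicToAdelic` ∕ `archToAdelic`), right translation `rightRep F V` of `U(V)(𝔸_{F⁺,f})` on `ℂ²`-valued functions on `U(V)(𝔸_{F⁺})`, the ONE hypothesis structure
`ArchFactor F V` (DATA: `ιinf : U(2,1) →* 𝒢(V).Adelic`, `Kc`) with its DEFINITIONAL predicate `ArchFactor.IsHonest`, and the `(1,0)`∕`(1,0)⊕(0,1)` COTANGENT AUTOMORPHIC FORMS `holCotForms 𝔞` ∕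
`cohForms 𝔞` (★ `weightForms`, ★ `BallForms.…cotangentCocycle.weightOf x₀`, ★ `HodgeCM.Model.holGerms`) — DEFINED, not posited.  No «honest factor exists» stub remains in either line
(v2.3): the factor of record is CONSTRUCTED; its honesty is P4's PROOF-lane certificate `archFactorOf_isHonest`, consumed by no composition.

## THE CUT (three stubs + two closed links; why this line)
* `stub_U1_realisationAt : StubU1RealisationAt` — **M–L (Matsushima–Hodge REALISATION at the factor of record; the INVERSE of P4-T2′'s class map — T2′ + U1′ say
  `cohForms 𝔞₀(V) ≅ H¹_{B,τ'}` equivariantly)**: `n = 3`, every `τ'`: an INJECTIVE `U(V)(𝔸_{F⁺,f})`-equivariant `ℂ`-linear map `r : H¹_{B,τ'}(A_∞, ℂ) → (U(V)(𝔸_{F⁺}) → ℂ²)` with values in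
  `cohForms (archFactorOf F V)` —
  every degree-1 class of the compact Kähler surface `P_Γ(V)` has a unique `(1,0) ⊕ (0,1)` harmonic = (anti)holomorphic representative ([VoisinHodgeI2002, Cor. 7.6 ∕ Prop. 6.11];
  [BorelWallach2000, VII 2.10, 3.2, 3.6] bigraded Matsushima; [Borel1997, §5.14] forms ↔ functions on the group), compatibly with pull-back and Hecke translation in the tower
  ([BorelWallach2000, XIII 1.2]).  Shared desk with P4-T2.
* `stub_U2_cohFormsSpectrumIsThetaAt : StubU2CohFormsSpectrumIsThetaAt` — **XL, THE LONG POLE (= P3's engine)**: `n = 3`: every IRREDUCIBLE `U(V)(𝔸_{F⁺,f})`-representation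
  `σ` admitting a non-zero equivariant map into `cohForms (archFactorOf F V)` (`OccursIn`) has a compact open level `K` and a GENUINE adèlic oscillator triple `t = (μ, ε, χ)` — `μ` of weight one,
  `ε` GLOBAL (`IsGlobalEps`: `ε = (e · Nm)_v` for one `e ∈ E^{×−}`, never the junk line) — with `σ` and `ω_V(t)` HECKE-RELATED at level `K` (`HeckeRelatedAt`: a linear map `σ → ω_V(t)`
  carrying `σ^K` into `ω_V(t)^K`, commuting there with every Hecke operator `[KgK]` of the tree's `heckeOperator`, non-zero on `σ^K` — the hypothesis shape of ★ `HeckeFixedVectorsLift`).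
  = [GR91, Introduction p. 448 L30–33] «every discrete `π` with `H¹(Lie(U), K, π_∞) ≠ 0` is a Weil representation» for the anisotropic `U(V)`, read on the finite part at finite level
  (the form a trace-formula ∕ `ℋ_K`-module comparison delivers, [BMM16 (Balls), Part 2 §1.8]): [Rogawski1990, §15.3 (held chunk p0223) «if `π_v = J_φ^±` for some `v ∈ S'_∞` then `π ∈ Π(ξ)`, `ξ`
  one-dimensional» = Thm. 13.3.6 (c) (p0178) + §14.4 (inner forms) + Prop. 15.2.1 (b) (= [BW] Thm. 4.11, `H¹ ≠ 0 ⇒ π_∞ = J^±`; cotangent weight = `J^±`, [Liu2021, Lem. D.2 (2)])],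
  [GR91 Lem. 5.1.2] the packet members are local Weil representations, Flath, and the dictionary [Liu2021, App. D Lem. D.1] `ω(μ_v, ε_v, χ_v) =` [GR90]'s local Weil representation.
  Promote∕split candidates (card): U2a cuspidal automorphic representation generated by a form in `cohForms` (★ `AdelicUnitaryGroupSpectrum`: `L² = L²_disc`), U2b archimedean type,
  U2c packets, U2d local theta + Flath + dictionary — the day `AutomorphyDatum` for `Hm V` in standard position and `J^±` are typed (today `UnitaryGroup.archGroup` needs a `StdForm`).
* **(v1's U3, CLOSED)** `heckeLevelRigidity_of_omegaIrreducibleOrZero` + `omegaIrreducibleOrZero_datum413`: an irreducible `σ` Hecke-related at a compact open level to `ω_V(t)` is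
  `≅ ω_V(t)` — ★ `HeckeFixedVectorsLift.nonempty_equiv_of_heckeEquivariant` ([BushnellHenniart2006, §4.3]; [Bump1997, Prop. 4.2.3]) once `ω_V(t) ≠ 0` is irreducible, and [Liu2021,
  Def. 4.11]'s «irreducible or zero» for the pin's `ω_V(t)` at every weight-one `μ` IS the route item `H411` (★ `Theorems.H411_proof`, read at the real scalar `repAt a₀ i.1`; the
  δ′-rest's `rho` is `datum413`'s by ★ `Model.restOfCharRep_eq_rest`, `rfl`).  Zero new facts.
* `stub_U4_signRule : StubU4SignRule` — **L (theta desk shared with P4-T3)**: a genuine weight-one `ω_V(μ,ε,χ)` (global `ε`) that OCCURS in `H¹_{B,τ'}` has `ε` `μ`-admissible — the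
  sign∕root-number rule ([GR91] p. 446 L9–11 = [Rogawski1992, Thm. 1.1] read in Liu's labels with [Liu2021, Lem. D.2 (2)], or theta dichotomy [HarrisKudlaSweet1996] + [Li1992]).
Composition (`dictionaryExistence_of_parts`, generic over `(P, R, A)`, kernel): from `σ ↪ H¹` and U1, `σ` occurs in `cohForms 𝔞` (`occursIn_of_realisedIn`: injective ∘ non-zero
intertwiner ≠ 0); U2 gives `(K, t)` with `σ`, `ω_V(t)` Hecke-related; the closed rigidity link gives `σ ≅ ω_V(t)`; occurrence moves along the isomorphism (★
`Prop413Data.occursInH1_of_equiv`); U4 gives admissibility; the witness is `⟨⟨t, hw, hadm⟩, f, hf⟩`; `𝔞` comes from U0 at the face.  WHY THIS LINE: it isolates the ONE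
trace-formula-bound statement (U2, stated on REAL automorphic forms with no posited object) from the Hodge∕Matsushima transfer (U1, shared with P4) and the sign rule (U4, theta
desk), with the representation theory between them (Hecke-level rigidity, Def. 4.11) ALREADY closed by name; its middle object is the same as P4's so the two programmes share the
`cohForms` API and the factor of record `archFactorOf F V` (no `∀ 𝔞, 𝔞.IsHonest →` binder: the assembly consumes ONE factor and never uses honesty).  Dead line avoided: the uniqueness conjunct of `oscillatorTriple_dictionary` and the unrestricted (⇒) half of
`muAdmissible_iff_multiplicity_one` are NOT claimed (edition E-III2; REF1 2026-08-28T12:49:36Z junk-`ε` witness) — U4 is that half RESTRICTED to global `ε`, print's domain.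
Barriers: none catalogued for HodgeConjecture in the representation-theory class (`Literature/Barriers/HodgeConjecture/`).

## References
* [Liu2021] Y. Liu, Camb. J. Math. 9 (2021) = arXiv:2102.11518 — Prop. 4.13 (FJcycle.tex l. 2113–2119) and proof l. 2121–2146 (l. 2131, l. 2145), Rem. 4.14 (l. 2148),
  Def. 4.11–4.12 (l. 2083–2110), App. D Lem. D.1 (l. 5241, 5255), Lem. D.2 (2) (l. 5274–5289).
* [GelbartRogawski1991] Invent. Math. 105 (1991): Introduction pp. 446–448, §3 Prop. 3.1.1, Thm. 5.1.1 p. 465, Lem. 5.1.2 p. 466.  [Rogawski1990] Ann. of Math. Stud. 123: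
  Thm. 13.3.1, Thm. 13.3.6, §14.6.  [Rogawski1992] Thm. 1.1.  [BorelWallach2000] VI; VII 2.10, 3.2, 3.6; XIII 1.2.  [VoganZuckerman1984].  [VoisinHodgeI2002] Prop. 6.11, Cor. 7.6.
  [Borel1997] §5.14.  [BernsteinZelevinsky1976] §2.10–2.11.  [BushnellHenniart2006] §4.2–4.3.  [BergeronMillsonMoeglin2016Balls] Acta Math. 216 (2016), Part 2 §1.8.  [HarrisKudlaSweet1996].  [Li1992] Thm. 2.1.
  [PlatonovRapinchuk1994] §5.1.  [BorelJacquet1979] §4.1–4.2.  [Mok2014] §1.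
* Tree: floor V7 ★ p756419; `Cruxes/H413/Lines/a3_liu413.lean` v10.2; `CorCM/Hyp413/A3Liu413FaceTypes.lean` (`datum413`); `GelbartRogawski1991/OscillatorTriple{Dictionary,
  ExistenceAndOccurrence}.lean`; `Liu2021/Prop413OccurrenceTransport.lean`; `Automorphic/{UnitaryGroupAutomorphicRep, UnitaryGroupRestrictedProduct, UnitaryGroupArchimedean,
  WeightForms, HeckeAlgebra, HeckeFixedVectorsLift, SmoothRepresentation}.lean`; `Liu2021/Def411AsPrinted.lean` (`IsIrreducibleOrZero`); `Theorems/HCCMUnconditionalH411.lean` (★ `H411_proof`); `ShimuraVarieties/UnitaryBallAutomorphicForms.lean`; `HodgeCM/Model/ThetaHolGerm.lean`;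
  `Theorems/HCCMUnconditionalH413OfFacts.lean` (`Hyp413Closing.H413_of_three_facts_flat`); carriers `Cruxes/H413/Lines/CohFormsCarriers.lean` (accd50068376).
-/

set_option autoImplicit false

-- the mandated namespace has the single-problem summit's repeated segment (`HodgeConjecture.HodgeConjecture`), as in every `Cruxes/…/Lines/*.lean` of this sub-problem
set_option linter.dupNamespace false

noncomputable section

namespace Summit.HodgeConjecture.HodgeConjecture.Cruxes.H413.P2ThetaDictionaryExists

open Summit.HodgeConjecture.HodgeConjecture.Cruxes.H413.SpectrumInterfaces

/-! ## §3  The REGISTERED STUBS (U1′ proved, U2′ folded by name over the sockets (C)∕(D), U4 open) — statements = the ★ module's constants (bodies token-identical to v3 :348 ∕ :371 ∕ :403);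
`sorry` lives ONLY in the socket (C) and in U4 (v4c: (C′) removed, (D̄) ⇐ (D); v4d: (D) ★ p799091). -/

/-- **`stub_U1_realisationAt`** — REGISTERED STUB U1′ (M–L): the injective equivariant Matsushima–Hodge realisation of the pin's `H¹_{B,τ'}(A_∞, ℂ)` in the `(1,0) ⊕ (0,1)` cotangent
automorphic forms for the factor of record (`StubU1RealisationAt`). [cite: BorelWallach2000, VII 3.2, VII 3.6, XIII 1.2] [cite: VoisinHodgeI2002, Prop. 6.11, Cor. 7.6] [cite: Borel1997, §5.14]
PROVED 2026-08-30 (F0P2-p04 (g0), by-name fold since v3.1): ★ p792926 `Theorems/P2StubU1RealisationAt.lean` :: `…Cruxes.H413.TowerRealisation.stubU1RealisationAt_holds`. -/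
theorem stub_U1_realisationAt : StubU1RealisationAt :=
  Summit.HodgeConjecture.HodgeConjecture.Cruxes.H413.TowerRealisation.stubU1RealisationAt_holds

/-- **SOCKET (C) — `stub_C_cohFinComponentIsTheta`** (class U, ENGINE E2∕E2b): the cohomological discrete automorphic representations of the definite-at-the-other-places inner form
`U(H)` with a finite component `σ` have `σ` Hecke-related to a restricted tensor product of local Weil representations attached to a weight-one CM character — the ★ statement-only
Literature constant `Rogawski1990.cohFinComponent_isTheta` BY NAME (p791977, reviewed).  Print anchors (prose, s355): Rogawski 1990 Thm. 13.3.6 (c), §14.6, §15.3 ¶1;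
Gelbart–Rogawski 1991 Thm. 5.1.1 p. 465, Lem. 5.1.2 p. 466; Liu 2021 App. D Lem. D.1. -/
theorem stub_C_cohFinComponentIsTheta : Literature.NumberTheory.Rogawski1990.cohFinComponent_isTheta := by
  sorry

/-- **SOCKET (D) — `stub_D_holCotFormSpectralProjection`** (class U, spectral projection, M–L in-tree later): the orthogonal projection onto a discrete automorphic `P` of the classes
of the coordinates of a HOLOMORPHIC cotangent form with `L²` coordinates are the classes of one holomorphic cotangent form — the ★ statement-only Literature constant
`UnitaryGroup.CotangentForms.holCotFormSpectralProjection` BY NAME (p792838).  Print anchors (prose): Borel–Jacquet 1979 §4.6; Deitmar–Echterhoff 2014 Thm. 7.3.2; Borel 1997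
Thm. 2.13 and §8.4; Harish-Chandra 1968; Borel–Wallach 2000 VII 2.10, XIII 1.2. -/
theorem stub_D_holCotFormSpectralProjection : Literature.NumberTheory.Automorphic.UnitaryGroup.CotangentForms.holCotFormSpectralProjection :=
  Summit.HodgeConjecture.HodgeConjecture.Cruxes.H413.F0P2dSocketD.holCotFormSpectralProjection_holds   -- v4d: (D) ★ p799091 (sub-line `F0_P2SpectralProjectionD`)

/-- **SOCKET (D̄) — `stub_D_antiholCotFormSpectralProjection`** (class U): the antiholomorphic twin of (D) — the ★ statement-only Literature constant
`UnitaryGroup.CotangentForms.antiholCotFormSpectralProjection` BY NAME (p792838).  Print anchors (prose): as (D). -/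
theorem stub_D_antiholCotFormSpectralProjection : Literature.NumberTheory.Automorphic.UnitaryGroup.CotangentForms.antiholCotFormSpectralProjection :=
  Literature.NumberTheory.Automorphic.UnitaryGroup.CotangentForms.antiholCotFormSpectralProjection_of_hol
    stub_D_holCotFormSpectralProjection   -- v4b: (D̄) ⇐ (D), ★ p794879 (F0P2-p01 (g2)); was `by sorry` in v4a

set_option synthInstance.maxHeartbeats 400000 in
set_option maxHeartbeats 8000000 in
/-- **`stub_U2_cohFormsSpectrumIsThetaAt`** — REGISTERED STUB U2′ (XL, THE LONG POLE): the `(1,0) ⊕ (0,1)` cotangent automorphic spectrum of `U(V)` (factor of record) is theta at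
finite level (`StubU2CohFormsSpectrumIsThetaAt`). [cite: GelbartRogawski1991, Introduction p. 448 L30–33; Thm 5.1.1 p. 465; Lemma 5.1.2 p. 466] [cite: Rogawski1990, Thm. 13.3.6; §14.4; §15.3]
[cite: Liu2021, Rem. 4.14; App. D Lem. D.1, Lem. D.2 (2)]
FOLDED BY NAME 2026-08-30 on the DETECTION ROUTE (F0P2-plan (g0) ruling 22:16:17Z): ★ p793253 `P2StubU2OfLetters.stubU2_of_letters` (F0P2-p03 (g0): smoothness ★ p792229,
`L²` classes ★ p792892, J1′ ★ p792074 ∕ `F0P3SpectralJunction`, Hodge split + detection via (D)∕(D̄)) applied to the pin bridge ★ p793582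
`ThetaPinBridge.spectrumIsTheta_of_cohFinComponent` (F0P2-p02 (g0): (C) at the frame data + (C′) + ★ p792371 `exists_heckeRelated_of_intertwiningMap`); v4c: (C′) is
DISCHARGED inside ★ p796532 `P2StubU2OfLettersCD.stub_U2_cohFormsSpectrumIsThetaAt_of_C_D` (★ P4 master p795659 via ★ p796158) and (D̄) by ★ p794879; open content = the
two sockets (C), (D). -/
theorem stub_U2_cohFormsSpectrumIsThetaAt : StubU2CohFormsSpectrumIsThetaAt :=
  Summit.HodgeConjecture.HodgeConjecture.Cruxes.H413.P2StubU2OfLettersCD.stub_U2_cohFormsSpectrumIsThetaAt_of_C_D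
    stub_C_cohFinComponentIsTheta stub_D_holCotFormSpectralProjection   -- v4c: (C′) removed, ★ p796532 (F0P2-p02 (g0)) over ★ p796158 + ★ p794879 + ★ p793253

/-- **`stub_U4_signRule`** — REGISTERED STUB U4 (L): the sign rule at the pin (`StubU4SignRule`). [cite: GelbartRogawski1991, Introduction p. 446 L9–11; Thm 5.1.1 p. 465]
[cite: Rogawski1992, Thm. 1.1] [cite: Liu2021, Def. 4.12; Lem. D.2 (2)] [cite: HarrisKudlaSweet1996] [cite: Li1992, Thm. 2.1]
STAYS the registered socket (F0P2-plan (g0) ruling 22:59:24Z): ★ p794032 `Theorems/P2StubU4OfParity.lean :: stubU4_of_parity (hE3 : StubE3OccurrenceParityAt) : StubU4SignRule`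
(F0P2-p04 (g0)) is an ADAPTER into the engine's parity dialect (Rogawski 1992 Thm. 1.1 read through ★ `Liu2021.isAdmissible_epsOf_iff_even`), booked as a transfer, not a close. -/
theorem stub_U4_signRule : StubU4SignRule := by
  sorry

/-! ## §4  The heads (kernel-checked, no `sorry` below this line; names as v3, terms = one-line folds of the ★ Kernel compositions) -/

/-- **HEAD 1 — the floor binder from the three stub STATEMENTS** (crux-plan shape `U1′ → U2′ → U4 → HdictEType`): ★ `SpectrumInterfaces.oscillatorTriple_dictionaryExistence_holds_of`
(= v3's generic composition `dictionaryExistence_of_parts` at `P = datum413 …`, `R = rightRep F V`, `A = cohForms (archFactorOf F V)`, Hecke-level rigidity and Def. 4.11 closed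
inside). [cite: Liu2021, proof of Prop. 4.13, l. 2145; Rem. 4.14] [cite: GelbartRogawski1991, Introduction p. 448 L30–33; Thm 5.1.1 p. 465] -/
theorem oscillatorTriple_dictionaryExistence_holds_of (h1 : StubU1RealisationAt) (h2 : StubU2CohFormsSpectrumIsThetaAt) (h4 : StubU4SignRule) : HdictEType :=
  SpectrumInterfaces.oscillatorTriple_dictionaryExistence_holds_of h1 h2 h4

/-- **HEAD 2 — `hdictE` DISCHARGED modulo the open sockets and U4**: the term a by-name fold of `a3_liu413.lean`'s `stub_oscillatorTriple_dictionaryExistence` consumes.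
[cite: Liu2021, proof of Prop. 4.13, l. 2145; Rem. 4.14] [cite: GelbartRogawski1991, Introduction p. 448 L30–33; Thm 5.1.1 p. 465] -/
theorem oscillatorTriple_dictionaryExistence_holds : HdictEType :=
  oscillatorTriple_dictionaryExistence_holds_of stub_U1_realisationAt stub_U2_cohFormsSpectrumIsThetaAt stub_U4_signRule

set_option synthInstance.maxHeartbeats 400000 in
set_option maxHeartbeats 8000000 in
/-- **HEAD 3 — the crux decl `HCCMUnconditional.H413` BY NAME from U1′, U2′, U4 and the other two floor rows (P3's `hJ3a`, P4's `hocc`)**, via ★ `Hyp413Closing.H413_of_three_facts_flat`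
(`hD3`, `hD1''` closed inside).  This is the theorem the line audit of crux item stmt-HodgeConjecture-24833 reads. [cite: Liu2021, Prop. 4.13 and proof l. 2121–2146; Rem. 4.14]
[cite: GelbartRogawski1991, Introduction p. 448; Thm 5.1.1] [cite: Rogawski1990, Thm. 13.3.1] -/
theorem H413_of_P2 (h1 : StubU1RealisationAt) (h2 : StubU2CohFormsSpectrumIsThetaAt) (h4 : StubU4SignRule) (hJ3a : HJ3aType) (hocc : HoccType) :
    Summit.HodgeConjecture.HodgeConjecture.Theses.HCCMUnconditional.H413 :=
  Summit.HodgeConjecture.CorCM.Hyp413Closing.H413_of_three_facts_flat (oscillatorTriple_dictionaryExistence_holds_of h1 h2 h4) hJ3a hocc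

/-- **HEAD 4 — zero-extra-hypothesis fold**: `H413` from P3's `hJ3a` and P4's `hocc` alone, `hdictE` supplied by this line's stubs (the shape the registry's by-name edition uses).
[cite: Liu2021, Prop. 4.13; Rem. 4.14] -/
theorem H413_of_stubs (hJ3a : HJ3aType) (hocc : HoccType) : Summit.HodgeConjecture.HodgeConjecture.Theses.HCCMUnconditional.H413 :=
  Summit.HodgeConjecture.CorCM.Hyp413Closing.H413_of_three_facts_flat oscillatorTriple_dictionaryExistence_holds hJ3a hocc

end Summit.HodgeConjecture.HodgeConjecture.Cruxes.H413.P2ThetaDictionaryExists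

end
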